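import Literature.NumberTheory.LFunctions.KMVCentralValueSquaredAFE
import Literature.NumberTheory.LFunctions.GL2CentralValueBridge
import Literature.NumberTheory.LFunctions.KMVCompletedLHalfIntegral
import Literature.NumberTheory.LFunctions.KMVCentralValueSquaredAFEHead
import Literature.NumberTheory.LFunctions.KMVCentralValueSquaredAFESeries
import Literature.NumberTheory.EllipticCurves.CuspFormFrickeAxisIntegral
import Literature.NumberTheory.EllipticCurves.EichlerIntegralFrickeProofs
import Literature.NumberTheory.EllipticCurves.PAdicLFunctionNonvanishingProofs
import Literature.NumberTheory.EllipticCurves.CuspFormLFunctionNewformFrickeProofs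
import HarnessLib

/-!
# FACT SKELETON `fricke-real-split` for H-AFE =
# `Literature.NumberTheory.LFunctions.KMV2000.completedL_half_sq_eq` (KMV 2000 (21)–(22), k = 0)

Cell landau-siegel / ls-inputs, seat ls-inputs-Hafe-lead g0 (K-INPUTS-7 (3)); card
`ls-inputs/Hafe/Lines/fricke-real-split.md`. Target (statements-first, p624193):

  `completedL_half_sq_eq : ∀ q prime, ∀ f ∈ newforms0 q 2,
     Summable (afeSqTerm q f) ∧ Λ(f,½)² = 2 q̂ Σ'_{ℕ×ℕ} λ_f(n₁)λ_f(n₂)(n₁n₂)^{-1/2} W(n₁n₂/q̂²)`,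
  `W = cutoffW`, `W(y) = ∫_0^∞ e^{-u-y/u} du` (= (1/2πi)∫_(3) Γ(1+t)² y^{-t} dt/t, KMV (21)).

MECHANISM (real-variable; no contour shift, no Stirling). Write `F(y) = f(iy)`,
`A = ∫_0^∞ F`, `T(y) = ∫_{v > 1/(Ny)} F(v) dv`, `H(y) = ∫_0^y F`.
* S1  `Λ(f,½) = 2π q̂^{1/2} A`                       (Γ(1) = 1, `L^*(f,1) = 2π·mellin F 1`).
* S2  Fricke on the axis: `T(y) = −ε H(y)`           (`f(i/(Nv)) = −ε N v² f(iv)`, `v = 1/(Nu)`).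
* S3  `∫_0^∞ F·H = A²/2`                              (FTC for `H²/2`).
* S4  `HasSum afeSqTerm (4π² ∫_0^∞ F·T)`              (q-expansion termwise, twice;
       `W(n₁n₂/q̂²) = 4π²n₁n₂ ∫∫_{y₁y₂>1/N} e^{−2π(n₁y₁+n₂y₂)}`; Hecke bound for summability).
* composition: newform ⇒ `w_N f = ε f`, `ε = ±1` (tree); `A = −εA` (tree's symmetric split at
  `1/√N` + `ε² = 1`); `2q̂·4π²·(−ε A²/2) = 4π² q̂ A² = Λ(f,½)²`.
v2 (all stubs LANDED, discharged BY NAME below; 0 sorry): S1 p625163 `KMV2000.completedL_half_eq_integral_all`,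
S2 p625399 `IsFrickeEigen.integral_imagAxis_Ioi_inv_mul_all`, S3 p625997 `KMV2000.integral_mul_head_all` (w1),
S4 p626035 `KMV2000.hasSum_afeSqTerm_all`; the Literature discharge is `KMV2000.completedL_half_sq_eq_holds`
(`KMVCentralValueSquaredAFEProofs`). The composition `completedL_half_sq_eq_of` is a real proof.
The theorem holds at EVERY level `N ≥ 1` for every Fricke eigen-cusp-form with `ε² = 1`
(`completedL_half_sq_eq_of_fricke`); the printed fact (prime level, newforms) is a specialisation.
-/

noncomputable section

open scoped Real
open Complex Set MeasureTheory Filter CongruenceSubgroup UpperHalfPlane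
open Literature.NumberTheory.EllipticCurves.ModularForms
open Literature.NumberTheory.LFunctions

namespace Literature.NumberTheory.LFunctions.KMV2000.FrickeRealSplit

/-! ## Stubs (registered signatures) -/

/-- **S1** `Λ(f,½) = 2π q̂^{1/2} ∫_0^∞ f(iy) dy` (KMV p. 1 definition of `Λ`; `Γ(1) = 1`;
`IwaniecSarnak.entireLSeries (cuspCoeff f) 2 = GL2Family.cuspFormLStar f`, `L^*(f,1) = 2π·∫_0^∞ f(iy)dy`). -/
theorem stub_completedL_half_eq_integral :
    ∀ (N : ℕ) [NeZero N] (f : CuspForm (Gamma0 N) 2),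
      KMV2000.completedL N f (1 / 2) =
        2 * (π : ℂ) * ((KMV2000.qhat N : ℝ) : ℂ) ^ (1 / 2 : ℂ) *
          ∫ y in Ioi (0 : ℝ), f (UpperHalfPlane.ofComplex (Complex.I * y)) :=
  KMV2000.completedL_half_eq_integral_all  -- S1 LANDED p625163 (lead)

/-- **S2** Fricke symmetry on the imaginary axis, integrated: for `f(-1/(Nτ)) = ε N τ² f(τ)` and
`y > 0`, `∫_{v > 1/(Ny)} f(iv) dv = −ε ∫_{0 < u ≤ y} f(iu) du` (substitution `v = 1/(Nu)`,
`f(i/(Nu)) = −ε N u² f(iu)`; the tree's `IsFrickeEigen.integral_imagAxis_Ioc_eq` is `y = 1/√N`). -/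
theorem stub_fricke_tail :
    ∀ (N : ℕ) [NeZero N] (f : CuspForm (Gamma0 N) 2) (ε : ℂ), IsFrickeEigen N f ε →
      ∀ y : ℝ, 0 < y →
        ∫ v in Ioi (((N : ℝ) * y)⁻¹), f (UpperHalfPlane.ofComplex (Complex.I * v)) =
          -ε * ∫ u in Ioc (0 : ℝ) y, f (UpperHalfPlane.ofComplex (Complex.I * u)) :=
  IsFrickeEigen.integral_imagAxis_Ioi_inv_mul_all  -- S2 LANDED p625399 (lead)

/-- **S3** `∫_0^∞ F(y) (∫_0^y F) dy = (∫_0^∞ F)²/2` for `F(y) = f(iy)` (FTC for `H²/2`,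
`H(y) = ∫_0^y F`; `F` continuous and integrable on `(0,∞)`, `H → A` at `∞`, `H(0⁺) = 0`). -/
theorem stub_integral_mul_head :
    ∀ (N : ℕ) [NeZero N] (f : CuspForm (Gamma0 N) 2),
      ∫ y in Ioi (0 : ℝ), f (UpperHalfPlane.ofComplex (Complex.I * y)) *
          ∫ u in Ioc (0 : ℝ) y, f (UpperHalfPlane.ofComplex (Complex.I * u)) =
        (∫ y in Ioi (0 : ℝ), f (UpperHalfPlane.ofComplex (Complex.I * y))) ^ 2 / 2 :=
  KMV2000.integral_mul_head_all  -- S3 LANDED p625997 (ls-inputs-Hafe-w1)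

/-- **S4** the series side: `Σ_{(n₁,n₂) ∈ ℕ×ℕ} λ_f(n₁)λ_f(n₂)(n₁n₂)^{-1/2} W(n₁n₂/q̂²)
= 4π² ∫_0^∞ f(iy) (∫_{v>1/(Ny)} f(iv) dv) dy` as a `HasSum` (q-expansion `f(iy) = Σ a_n e^{-2πny}`
integrated termwise twice; `∫_0^∞ e^{-2πn₁y} e^{-2πn₂/(Ny)} dy = W(4π²n₁n₂/N)/(2πn₁)`, `q̂² = N/4π²`;
absolute convergence from Hecke's bound `a_n = O(n)` and `W(y) ≤ 2e^{-√y}`). -/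
theorem stub_hasSum_afeSqTerm :
    ∀ (N : ℕ) [NeZero N] (f : CuspForm (Gamma0 N) 2),
      HasSum (KMV2000.afeSqTerm N f)
        (4 * (π : ℂ) ^ 2 *
          ∫ y in Ioi (0 : ℝ), f (UpperHalfPlane.ofComplex (Complex.I * y)) *
            ∫ v in Ioi (((N : ℝ) * y)⁻¹), f (UpperHalfPlane.ofComplex (Complex.I * v))) :=
  KMV2000.hasSum_afeSqTerm_all  -- S4 LANDED p626035 (lead)

/-! ## Composition (kernel-checked; v2: no `sorry` anywhere) -/

/-- `A = −ε A` for `A = ∫_0^∞ f(iy) dy` when `w_N f = ε f`, `ε² = 1`: the tree's symmetric split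
`∫_0^{1/√N} F = −ε ∫_{1/√N}^∞ F` (`IsFrickeEigen.integral_imagAxis_Ioc_eq`). -/
theorem integral_imagAxis_eq_neg_eps_mul {N : ℕ} [NeZero N] (f : CuspForm (Gamma0 N) 2) {ε : ℂ}
    (hW : IsFrickeEigen N f ε) (hε : ε ^ 2 = 1) :
    ∫ y in Ioi (0 : ℝ), f (UpperHalfPlane.ofComplex (Complex.I * y)) =
      -ε * ∫ y in Ioi (0 : ℝ), f (UpperHalfPlane.ofComplex (Complex.I * y)) := by
  set g : ℝ → ℂ := fun t ↦ f (UpperHalfPlane.ofComplex (Complex.I * t)) with hg_def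
  set b : ℝ := (Real.sqrt N)⁻¹ with hb_def
  have hb : 0 < b := inv_pos.mpr (Real.sqrt_pos.mpr (by exact_mod_cast NeZero.pos N))
  have hg : IntegrableOn g (Ioi 0) := integrableOn_imagAxis f
  have hsplit : ∫ t in Ioi (0 : ℝ), g t = (∫ t in Ioc 0 b, g t) + ∫ t in Ioi b, g t := by
    have h := intervalIntegral.integral_Ioi_sub_Ioi hg hb.le
    rw [intervalIntegral.integral_of_le hb.le] at h
    linear_combination h
  have hflip : ∫ t in Ioc (0 : ℝ) b, g t = -ε * ∫ t in Ioi b, g t := hW.integral_imagAxis_Ioc_eq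
  rw [hsplit, hflip]
  linear_combination (-(∫ t in Ioi b, g t)) * hε

/-- **The identity at every level for Fricke eigenforms**: if `f ∈ S₂(Γ₀(N))`, `w_N f = ε f` with
`ε² = 1`, then `Summable (afeSqTerm N f)` and `Λ(f,½)² = 2 q̂ Σ' afeSqTerm N f` — from the stubs. -/
theorem completedL_half_sq_eq_of_fricke
    (h1 : ∀ (N : ℕ) [NeZero N] (f : CuspForm (Gamma0 N) 2),
      KMV2000.completedL N f (1 / 2) =
        2 * (π : ℂ) * ((KMV2000.qhat N : ℝ) : ℂ) ^ (1 / 2 : ℂ) *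
          ∫ y in Ioi (0 : ℝ), f (UpperHalfPlane.ofComplex (Complex.I * y)))
    (h2 : ∀ (N : ℕ) [NeZero N] (f : CuspForm (Gamma0 N) 2) (ε : ℂ), IsFrickeEigen N f ε →
      ∀ y : ℝ, 0 < y →
        ∫ v in Ioi (((N : ℝ) * y)⁻¹), f (UpperHalfPlane.ofComplex (Complex.I * v)) =
          -ε * ∫ u in Ioc (0 : ℝ) y, f (UpperHalfPlane.ofComplex (Complex.I * u)))
    (h3 : ∀ (N : ℕ) [NeZero N] (f : CuspForm (Gamma0 N) 2),
      ∫ y in Ioi (0 : ℝ), f (UpperHalfPlane.ofComplex (Complex.I * y)) *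
          ∫ u in Ioc (0 : ℝ) y, f (UpperHalfPlane.ofComplex (Complex.I * u)) =
        (∫ y in Ioi (0 : ℝ), f (UpperHalfPlane.ofComplex (Complex.I * y))) ^ 2 / 2)
    (h4 : ∀ (N : ℕ) [NeZero N] (f : CuspForm (Gamma0 N) 2),
      HasSum (KMV2000.afeSqTerm N f)
        (4 * (π : ℂ) ^ 2 *
          ∫ y in Ioi (0 : ℝ), f (UpperHalfPlane.ofComplex (Complex.I * y)) *
            ∫ v in Ioi (((N : ℝ) * y)⁻¹), f (UpperHalfPlane.ofComplex (Complex.I * v))))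
    {N : ℕ} [NeZero N] (f : CuspForm (Gamma0 N) 2) {ε : ℂ}
    (hfr : frickeInvolution N 2 f = ε • f) (hε : ε ^ 2 = 1) :
    Summable (KMV2000.afeSqTerm N f) ∧
      KMV2000.completedL N f (1 / 2) ^ 2 =
        2 * (KMV2000.qhat N : ℂ) * ∑' n : ℕ × ℕ, KMV2000.afeSqTerm N f n := by
  have hW : IsFrickeEigen N f ε := isFrickeEigen_of_frickeInvolution_eq_smul N hfr
  refine ⟨(h4 N f).summable, ?_⟩
  -- the inner tail integral is `-ε ∫_{Ioc 0 y} F` on `Ioi 0`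
  have hT : ∫ y in Ioi (0 : ℝ), f (UpperHalfPlane.ofComplex (Complex.I * y)) *
        ∫ v in Ioi (((N : ℝ) * y)⁻¹), f (UpperHalfPlane.ofComplex (Complex.I * v)) =
      -ε * ∫ y in Ioi (0 : ℝ), f (UpperHalfPlane.ofComplex (Complex.I * y)) *
        ∫ u in Ioc (0 : ℝ) y, f (UpperHalfPlane.ofComplex (Complex.I * u)) := by
    rw [← integral_const_mul]
    refine setIntegral_congr_fun measurableSet_Ioi fun y hy ↦ ?_
    rw [h2 N f ε hW y hy]
    ring
  have hA0 := integral_imagAxis_eq_neg_eps_mul f hW hε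
  have hsq : (((KMV2000.qhat N : ℝ) : ℂ) ^ (1 / 2 : ℂ)) ^ 2 = (KMV2000.qhat N : ℂ) := by
    rw [← cpow_nat_mul]
    norm_num
  rw [(h4 N f).tsum_eq, h1 N f, hT, h3 N f]
  set A : ℂ := ∫ y in Ioi (0 : ℝ), f (UpperHalfPlane.ofComplex (Complex.I * y)) with hA_def
  have hA' : ε * A = -A := by linear_combination ε * hA0 - A * hε
  rw [mul_pow, mul_pow, hsq]
  linear_combination (4 : ℂ) * (π : ℂ) ^ 2 * (KMV2000.qhat N : ℂ) * A * hA'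

/-- **Composition**: the four stubs give the printed fact BY NAME (newforms have `w_q f = ε_f f`,
`ε_f = ±1`: `IsNewform0.frickeInvolution_eq_smul_holds`, `…frickeEigenvalue_eq_one_or_eq_neg_one_holds`). -/
theorem completedL_half_sq_eq_of
    (h1 : ∀ (N : ℕ) [NeZero N] (f : CuspForm (Gamma0 N) 2),
      KMV2000.completedL N f (1 / 2) =
        2 * (π : ℂ) * ((KMV2000.qhat N : ℝ) : ℂ) ^ (1 / 2 : ℂ) *
          ∫ y in Ioi (0 : ℝ), f (UpperHalfPlane.ofComplex (Complex.I * y)))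
    (h2 : ∀ (N : ℕ) [NeZero N] (f : CuspForm (Gamma0 N) 2) (ε : ℂ), IsFrickeEigen N f ε →
      ∀ y : ℝ, 0 < y →
        ∫ v in Ioi (((N : ℝ) * y)⁻¹), f (UpperHalfPlane.ofComplex (Complex.I * v)) =
          -ε * ∫ u in Ioc (0 : ℝ) y, f (UpperHalfPlane.ofComplex (Complex.I * u)))
    (h3 : ∀ (N : ℕ) [NeZero N] (f : CuspForm (Gamma0 N) 2),
      ∫ y in Ioi (0 : ℝ), f (UpperHalfPlane.ofComplex (Complex.I * y)) *
          ∫ u in Ioc (0 : ℝ) y, f (UpperHalfPlane.ofComplex (Complex.I * u)) =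
        (∫ y in Ioi (0 : ℝ), f (UpperHalfPlane.ofComplex (Complex.I * y))) ^ 2 / 2)
    (h4 : ∀ (N : ℕ) [NeZero N] (f : CuspForm (Gamma0 N) 2),
      HasSum (KMV2000.afeSqTerm N f)
        (4 * (π : ℂ) ^ 2 *
          ∫ y in Ioi (0 : ℝ), f (UpperHalfPlane.ofComplex (Complex.I * y)) *
            ∫ v in Ioi (((N : ℝ) * y)⁻¹), f (UpperHalfPlane.ofComplex (Complex.I * v)))) :
    KMV2000.completedL_half_sq_eq := by
  intro q _ _hq f hf
  have hfr : frickeInvolution q 2 f = frickeEigenvalue f • f :=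
    IsNewform0.frickeInvolution_eq_smul_holds hf
  have hε : frickeEigenvalue f ^ 2 = 1 := by
    rcases IsNewform0.frickeEigenvalue_eq_one_or_eq_neg_one_holds (N := q) (k := (2 : ℤ)) hf with
      h | h <;> rw [h] <;> norm_num
  exact completedL_half_sq_eq_of_fricke h1 h2 h3 h4 f hfr hε

/-- The fact from the stubs, BY NAME. -/
theorem completedL_half_sq_eq_of_stubs : KMV2000.completedL_half_sq_eq :=
  completedL_half_sq_eq_of stub_completedL_half_eq_integral stub_fricke_tail
    stub_integral_mul_head stub_hasSum_afeSqTerm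

end Literature.NumberTheory.LFunctions.KMV2000.FrickeRealSplit

end
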